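import Mathlib.Analysis.InnerProductSpace.Basic
import HarnessLib

/-!
# Stability of a gapped top eigenvector (Davis–Kahan in one line): the frozen fibre ground state moves LIPSCHITZ-ly with the fibre kernel
# (route `FlatTubeReduction`, crux K1 `NearFlatRatioLaw` stmt-QuantumFields-24720, registered stub `stub_boRate` = FCL 23943's `BORateAll`; line «borate»;
# rung R2b1 = RECORD-label femto gap; no summit statement is proved here)

Seat `ym-line-ftr-p1` g7 (prover).  The CROSS block (P4) of the Born–Oppenheimer door pays the TRANSPORT DEFECT `τ` of the fibre profile across one kinetic step
(`…FibredBOCross`, `…FibredBOCrossRes`, `…FibredBOTransport`: `τ ≲ M_G·‖m_cΩ_c − m_{c'}Ω_{c'}‖²`).  For the rate twin `τ = O(β^{-1})` is needed, i.e. the c-frozen fibre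
ground state `Ω_c` must be LIPSCHITZ in the fibre data (`|c − c'| ≍ β^{-1/2}` per step) — a form-level (variational) argument only gives Hölder-½.  The operator-level
argument below gives Lipschitz from three inputs the tree already has for Gaussian fibres: the exact eigen-equation of the profile (Literature
`GaussianTransferKernel.integral_gaussKernel_mul_groundState_symm`), the form gap on its orthocomplement (lane A `…MehlerGap`/`…MehlerTensorGap`), and a bound on
`(K − K')Ω` (kernel difference × Schur, g6 `…FibredBOGaussLipschitz`).  Abstractly, on a real inner product space `E` with linear `K, K'`:
* ★★ `norm_sub_proj_le_of_gap` — `KΩ = λΩ` (`‖Ω‖ = 1`), `K'Ω' = λ'Ω'`, gap `⟪w,Kw⟫ ≤ (λ − γ)‖w‖²` for `w ⊥ Ω` (`γ > 0`) ⇒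
  `‖Ω' − ⟪Ω',Ω⟫Ω‖ ≤ (‖(K − K')Ω'‖ + |λ' − λ|·‖Ω'‖)/γ`;
* ★ `eigenvalue_sub_le` / `abs_eigenvalue_sub_le` — tops `⟪v,Kv⟫ ≤ λ‖v‖²`, `⟪v,K'v⟫ ≤ λ'‖v‖²` attained by unit eigenvectors `Ω, Ω'` ⇒
  `λ' − λ ≤ ⟪Ω',(K'−K)Ω'⟫`, `λ − λ' ≤ ⟪Ω,(K−K')Ω⟫`, hence `|λ − λ'| ≤ δ` when both diagonal forms of the perturbation are `≤ δ` (variational; no gap needed);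
* ★★ `norm_sub_le_of_gap` — with `⟪Ω',Ω⟫ ≥ 0` (sign choice) and `‖Ω'‖ = 1`: `‖Ω' − Ω‖ ≤ √2·(‖(K−K')Ω'‖ + |λ'−λ|)/γ` — LIPSCHITZ in the perturbation.
HONEST FRAMING: elementary Hilbert-space algebra for the registered stub of a crux of the CONDITIONAL reduction route to the femto rung R2b1 (RECORD label); the fibre kernels it
will be applied to are route RED lane A's (C4-CORE, OPEN) at frozen slow variable; nothing here is infinite volume, a continuum limit or the Clay mass gap.  No definitions, no `sorry`.

## References
* C. Davis, W. M. Kahan, *The rotation of eigenvectors by a perturbation III*, SIAM J. Numer. Anal. 7 (1970) 1–46 (sin θ theorem) — [folklore] form used here.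
* S. J. Gustafson, I. M. Sigal, *Mathematical Concepts of Quantum Mechanics*, Springer 2003, §12 (adiabatic/Born–Oppenheimer projections) — [cite: GustafsonSigal2003, §12].
-/

set_option autoImplicit false

noncomputable section

open scoped RealInnerProductSpace

namespace Summit.QuantumFields.YangMills.Theorems.FemtoTransferGap.FibredBO

variable {E : Type*} [NormedAddCommGroup E] [InnerProductSpace ℝ E]

/-- ★★ **Gapped top eigenvector: the orthogonal component of a nearby eigenvector is first order in the perturbation.**  `K Ω = λΩ` with `‖Ω‖ = 1`,
`K' Ω' = λ'Ω'`, and the form gap `⟪w, Kw⟫ ≤ (λ − γ)‖w‖²` on `Ω^⊥` (`γ > 0`).  Then `w := Ω' − ⟪Ω',Ω⟫Ω` satisfies `‖w‖ ≤ (‖(K − K')Ω'‖ + |λ' − λ|‖Ω'‖)/γ`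
(because `(K − λ)w = (K − λ)Ω' = (K − K')Ω' + (λ' − λ)Ω'` and `γ‖w‖² ≤ ⟪w,(λ − K)w⟫ ≤ ‖w‖·‖(K−λ)w‖`). [folklore] -/
theorem norm_sub_proj_le_of_gap (K K' : E →ₗ[ℝ] E) {Ω Ω' : E} {lam lam' γ : ℝ} (hΩ : ‖Ω‖ = 1) (hK : K Ω = lam • Ω) (hK' : K' Ω' = lam' • Ω')
    (hγ : 0 < γ) (hgap : ∀ w : E, ⟪w, Ω⟫ = 0 → ⟪w, K w⟫ ≤ (lam - γ) * ‖w‖ ^ 2) :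
    ‖Ω' - ⟪Ω', Ω⟫ • Ω‖ ≤ (‖(K - K') Ω'‖ + |lam' - lam| * ‖Ω'‖) / γ := by
  set α := ⟪Ω', Ω⟫ with hα
  set w := Ω' - α • Ω with hw
  -- `w ⊥ Ω`
  have hwΩ : ⟪w, Ω⟫ = 0 := by
    rw [hw, inner_sub_left, inner_smul_left, real_inner_self_eq_norm_sq, hΩ]
    simp [hα]
  -- the residual identity `(K − λ) w = (K − K')Ω' + (λ' − λ)Ω'`
  set r := (K - K') Ω' + (lam' - lam) • Ω' with hr
  have hres : K w - lam • w = r := by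
    have e1 : K w = K Ω' - α • (lam • Ω) := by rw [hw, map_sub, map_smul, hK]
    rw [e1, hr, LinearMap.sub_apply, hK', hw]
    module
  have hrn : ‖r‖ ≤ ‖(K - K') Ω'‖ + |lam' - lam| * ‖Ω'‖ := by
    rw [hr]
    refine (norm_add_le _ _).trans (add_le_add le_rfl ?_)
    rw [norm_smul, Real.norm_eq_abs]
  -- gap + Cauchy–Schwarz
  have hg := hgap w hwΩ
  have h1 : γ * ‖w‖ ^ 2 ≤ -⟪w, r⟫ := by
    have e : ⟪w, r⟫ = ⟪w, K w⟫ - lam * ‖w‖ ^ 2 := by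
      rw [← hres, inner_sub_right, inner_smul_right, real_inner_self_eq_norm_sq]
    rw [e]; linarith
  have h2 : -⟪w, r⟫ ≤ ‖w‖ * ‖r‖ := by
    have := abs_real_inner_le_norm w r
    have := neg_abs_le ⟪w, r⟫
    linarith
  have h3 : γ * ‖w‖ ^ 2 ≤ ‖w‖ * ‖r‖ := h1.trans h2
  by_cases hw0 : ‖w‖ = 0
  · rw [hw0]; positivity
  · have hwpos : 0 < ‖w‖ := lt_of_le_of_ne (norm_nonneg _) (Ne.symm hw0)
    rw [le_div_iff₀ hγ]
    have h4 : γ * ‖w‖ ≤ ‖r‖ := by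
      have := h3; rw [sq] at this
      nlinarith
    calc ‖w‖ * γ = γ * ‖w‖ := mul_comm _ _
      _ ≤ ‖r‖ := h4
      _ ≤ _ := hrn

/-- ★ **Top eigenvalues move by at most the form of the perturbation**: if `λ` bounds the form of `K` and `Ω'` is a unit eigenvector of `K'` with eigenvalue `λ'`, then
`λ' − λ ≤ ⟪Ω', (K' − K)Ω'⟫`; symmetrically with the roles exchanged.  (Variational; no gap needed.) [folklore] -/
theorem eigenvalue_sub_le (K K' : E →ₗ[ℝ] E) {Ω' : E} {lam lam' : ℝ} (hΩ' : ‖Ω'‖ = 1) (hK' : K' Ω' = lam' • Ω')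
    (htop : ∀ v : E, ⟪v, K v⟫ ≤ lam * ‖v‖ ^ 2) : lam' - lam ≤ ⟪Ω', (K' - K) Ω'⟫ := by
  have h1 : ⟪Ω', K' Ω'⟫ = lam' := by rw [hK', inner_smul_right, real_inner_self_eq_norm_sq, hΩ']; ring
  have h2 := htop Ω'
  rw [hΩ'] at h2
  rw [LinearMap.sub_apply, inner_sub_right, h1]
  linarith

/-- `|λ − λ'| ≤ δ` when both tops are attained by unit eigenvectors and the perturbation's diagonal forms on them are `≤ δ` in absolute value. [folklore] -/
theorem abs_eigenvalue_sub_le (K K' : E →ₗ[ℝ] E) {Ω Ω' : E} {lam lam' δ : ℝ} (hΩ : ‖Ω‖ = 1) (hΩ' : ‖Ω'‖ = 1) (hK : K Ω = lam • Ω)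
    (hK' : K' Ω' = lam' • Ω') (htop : ∀ v : E, ⟪v, K v⟫ ≤ lam * ‖v‖ ^ 2) (htop' : ∀ v : E, ⟪v, K' v⟫ ≤ lam' * ‖v‖ ^ 2)
    (hδ : |⟪Ω, (K' - K) Ω⟫| ≤ δ) (hδ' : |⟪Ω', (K' - K) Ω'⟫| ≤ δ) : |lam - lam'| ≤ δ := by
  have h1 := eigenvalue_sub_le K K' hΩ' hK' htop
  have h2 := eigenvalue_sub_le K' K hΩ hK htop'
  have e : ⟪Ω, (K - K') Ω⟫ = -⟪Ω, (K' - K) Ω⟫ := by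
    rw [LinearMap.sub_apply, LinearMap.sub_apply, inner_sub_right, inner_sub_right]; ring
  rw [e] at h2
  rw [abs_le]
  constructor
  · have := (abs_le.mp hδ').2; linarith
  · have := (abs_le.mp hδ).1; linarith

/-- ★★ **Lipschitz stability of the gapped top eigenvector** (sign fixed by `⟪Ω',Ω⟫ ≥ 0`, both unit): under the hypotheses of `norm_sub_proj_le_of_gap`,
`‖Ω' − Ω‖ ≤ √2·(‖(K − K')Ω'‖ + |λ' − λ|)/γ` — FIRST order in the perturbation (the form-level argument would give only its square root).  In the rate twin:
`Ω = Ω_c`, `Ω' = Ω_{c'}` frozen Gaussian fibre ground states across one kinetic step, `‖K_c − K_{c'}‖ = O(|c − c'|) = O(β^{-1/2})`, `γ ≍` the Mehler gap ⇒ transport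
defect `‖Ω_c − Ω_{c'}‖² = O(β^{-1})`. [folklore] [cite: GustafsonSigal2003, §12] -/
theorem norm_sub_le_of_gap (K K' : E →ₗ[ℝ] E) {Ω Ω' : E} {lam lam' γ : ℝ} (hΩ : ‖Ω‖ = 1) (hΩ' : ‖Ω'‖ = 1) (hK : K Ω = lam • Ω)
    (hK' : K' Ω' = lam' • Ω') (hγ : 0 < γ) (hgap : ∀ w : E, ⟪w, Ω⟫ = 0 → ⟪w, K w⟫ ≤ (lam - γ) * ‖w‖ ^ 2) (hsign : 0 ≤ ⟪Ω', Ω⟫) :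
    ‖Ω' - Ω‖ ≤ Real.sqrt 2 * ((‖(K - K') Ω'‖ + |lam' - lam|) / γ) := by
  have hw := norm_sub_proj_le_of_gap K K' hΩ hK hK' hγ hgap
  rw [hΩ', mul_one] at hw
  set α := ⟪Ω', Ω⟫ with hα
  set D := (‖(K - K') Ω'‖ + |lam' - lam|) / γ with hD
  have hD0 : 0 ≤ D := by positivity
  -- Pythagoras: ‖Ω'‖² = α² + ‖w‖², and ‖Ω' − Ω‖² = 2 − 2α
  have hc : ⟪Ω, Ω'⟫ = α := real_inner_comm Ω' Ω
  have hwsq : ‖Ω' - α • Ω‖ ^ 2 = 1 - α ^ 2 := by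
    rw [← real_inner_self_eq_norm_sq, inner_sub_left, inner_sub_right, inner_sub_right, inner_smul_left, inner_smul_right, inner_smul_left,
      inner_smul_right, real_inner_self_eq_norm_sq, real_inner_self_eq_norm_sq, hΩ, hΩ', hc, ← hα]
    simp only [RCLike.conj_to_real]
    ring
  have hdist : ‖Ω' - Ω‖ ^ 2 = 2 - 2 * α := by
    rw [← real_inner_self_eq_norm_sq, inner_sub_left, inner_sub_right, inner_sub_right, real_inner_self_eq_norm_sq, real_inner_self_eq_norm_sq,
      hΩ, hΩ', hc, ← hα]
    ring
  have hα1 : α ≤ 1 := by nlinarith [sq_nonneg ‖Ω' - α • Ω‖]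
  -- `2 − 2α ≤ 2(1 − α²) = 2‖w‖²` since `0 ≤ α ≤ 1`
  have hkey : ‖Ω' - Ω‖ ^ 2 ≤ 2 * D ^ 2 := by
    have h1 : 2 - 2 * α ≤ 2 * (1 - α ^ 2) := by nlinarith
    have h2 : 1 - α ^ 2 ≤ D ^ 2 := by
      rw [← hwsq]; exact pow_le_pow_left₀ (norm_nonneg _) hw 2
    nlinarith
  have h3 : ‖Ω' - Ω‖ ≤ Real.sqrt (2 * D ^ 2) := by
    rw [← Real.sqrt_sq (norm_nonneg (Ω' - Ω))]
    exact Real.sqrt_le_sqrt hkey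
  rw [Real.sqrt_mul (by norm_num), Real.sqrt_sq hD0] at h3
  exact h3

end Summit.QuantumFields.YangMills.Theorems.FemtoTransferGap.FibredBO

end
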